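import Summits.AtomisticToContinuum.BoseEinsteinCondensation.Theorems.BoxHorizonAffinityB
import HarnessLib

/-!
# BoxCountShadow — lens-6 carving #3 (gen 35): the diagonal residual moved onto the COUNT LATTICE

Cell `decomp-a2c`, lens 6 «barrier-complement carving», conjunct `BoseEinsteinCondensation`, box line
(stmt-AtomisticToContinuum-27506).  Target of this generation = the declared residual of carving #2,
`BoxHorizonAffinity.GroundStateHorizonLabelAffinity η` (LAB_h(η), IDEA-NEEDED · UNDECIDED-DIAGONAL; kernel of
record `bec_of_horizonAffinity₀ : UGS → LOC_h(η) → LAB_h(η) → BoseEinsteinCondensation`).  Gen 34 showed the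
SCALE axis is exhausted (LAB_h is the weakest placement of the diagonal residual on it); gen 35 CHANGES THE
OBSERVABLE.

THE NEW OBSERVABLE.  The HORIZON-CELL COUNT FIELD of the environment, `m(Y) = (n_B(Y))_{B ∈ P_K³} ∈ ℕ^{K³}`
(`n_B(Y)` = number of the other `N − 1` particles in block `B`), and through it the LAW `p_N` of the count
vector of `|Ψ₀|²` — `K³` integers instead of a configuration `Y ∈ ℝ^{3(N-1)}`.  Every functional below is a
functional of the two fibre masses `P̄(m) = ∫_{m(Y)=m} P̂(Y) dY` (law of the environment counts) and
`Q(B,m) = ∫_{m(Y)=m} q_B(Y) dY = p_N(m + e_B)(m_B + 1)/N` (joint law of «block of particle 1, counts of the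
others»):

* `countAffinity  = Σ_m P̄(m)^{1/2} Σ_B K^{-3/2} Q(B,m)^{1/2}` — the INSERTION affinity of the count law: the
  `P̄`-average of the Bhattacharyya coefficient between the conditional law of the inserted particle's block
  GIVEN ONLY THE COUNTS, `r(B|m) ∝ p_N(m+e_B)(m_B+1)`, and the uniform law on the `K³` blocks;
* `transferAffinity B B' = Σ_m Q(B,m)^{1/2} Q(B',m)^{1/2}` — the COUNT-TRANSFER affinity `B' → B` of `p_N`;
* `countTransfer = Σ_m (Σ_B K^{-3/2} Q(B,m)^{1/2})² = K⁻³ Σ_{B,B'} transferAffinity B B'`.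

THEOREMS (0 sorry; §1 abstract, §3 physical):
* `labelAffinity_le_countAffinity` — LAB(K) ≤ countAffinity(K) (fibrewise Cauchy–Schwarz = data processing):
  count tolerance is WEAKER than label affinity;
* `blockCoherence_le_transferAffinity` — THE COUNT SHADOW: `(1/N)⟨u_B, γ_Φ u_{B'}⟩ ≤ transferAffinity B B'`
  ENTRYWISE: the count-transfer affinity matrix of `p_N` majorises the block-coarse-grained one-body density
  matrix; summed, `occupation_flat_le_countTransfer`: `n(u_L)/N ≤ countTransfer(K) ≤ countAffinity(K)` at
  EVERY scale `K` — count rigidity of `|Φ|²` at ANY scale kills flat-mode BEC quantitatively, for every state;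
* `countAffinity_le_one`, `countTransfer_le_countAffinity`, `countAffinity_sq_le_countTransfer` (normalised
  `Φ`): `T ≤ A ≤ min(1, T^{1/2})` — insertion tolerance and pair-averaged transfer tolerance of the count law
  are one currency.

THE CARVING (exact, both pieces necessary):
  LAB_h(η) ⟺ NUM_h(η) ∧ SUF_h(η)      (`horizonLabelAffinity_iff_count`)
with
* NUM_h(η) `GroundStateHorizonCountAffinity η` (crux · DECLARED RESIDUAL of gen 35 · TAG WEAKER (than LAB_h,
  proved) · UNDECIDED-COUNT · TRUE-type · NECESSARY for flat BEC (proved) · leaf IDEA-NEEDED, class = number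
  rigidity / insertion tolerance of a law on `ℕ^{K³}`): the count law of `|Ψ₀|²` is insertion tolerant at all
  sufficiently coarse horizon windows;
* SUF_h(η) `GroundStateHorizonCountSufficiency η` (crux · TAG WEAKER-OR-EQUAL (than LAB_h, proved) ·
  UNDECIDED-LOCAL · leaf ATTACKABLE·conditional, class = count SUFFICIENCY: the environment's geometry beyond
  its horizon counts locates particle 1 at most `|log s|` better, in Bhattacharyya terms);
and the deciding kernel `bec_of_countPieces₀ : UGS → LOC_h(η) → NUM_h(η) → SUF_h(η) → BoseEinsteinCondensation`.

MUST-FAIL probes (bc/probes_mustfail.lean): NUM_h → LAB_h ✗, SUF_h → LAB_h ✗, NUM_h → BEC ✗, ⊢ NUM_h ✗,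
⊢ SUF_h ✗; controls NUM_h → SUF_h → LAB_h ✓, LAB_h → NUM_h ✓, LAB_h → SUF_h ✓.

No instances, no notation, no sorry; imports = the landed Part II of carving #2 + HarnessLib.
-/

open MeasureTheory Filter Set
open scoped ENNReal NNReal BigOperators

namespace Summit.AtomisticToContinuum.BoseEinsteinCondensation.Theorems.BoxCountShadow

open Literature.MathematicalPhysics.QuantumManyBody.BoseGas
open Summit.AtomisticToContinuum.BoseEinsteinCondensation.Theorems.BoxLatticeFSum
open Summit.AtomisticToContinuum.BoseEinsteinCondensation.Theorems.BoxLabelAffinity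
open Summit.AtomisticToContinuum.BoseEinsteinCondensation.Theorems.BoxHorizonAffinity

/-! ### §1  Abstract layer: fibres of a countable statistic, fibrewise Cauchy–Schwarz -/

section Abstract

variable {β : Type*} [MeasurableSpace β] {σ : Type*} [MeasurableSpace σ] [MeasurableSingletonClass σ]
  [Countable σ]

/-- **Fibre decomposition**: for a measurable statistic `T` with countably many values,
`∫ f = Σ'_m ∫_{T = m} f`. [folklore] -/
theorem lintegral_eq_tsum_fibre (ν : Measure β) {T : β → σ} (hT : Measurable T) (f : β → ℝ≥0∞) :
    ∫⁻ b, f b ∂ν = ∑' m, ∫⁻ b in T ⁻¹' {m}, f b ∂ν := by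
  have hd : Pairwise (Function.onFun Disjoint fun m : σ => T ⁻¹' ({m} : Set σ)) := fun m m' h =>
    (Set.disjoint_singleton.2 h).preimage T
  have hU : (⋃ m : σ, T ⁻¹' ({m} : Set σ)) = Set.univ := by
    ext b
    simp only [Set.mem_iUnion, Set.mem_preimage, Set.mem_singleton_iff, exists_eq', Set.mem_univ]
  rw [← lintegral_iUnion (fun m => hT (measurableSet_singleton m)) hd f, hU, Measure.restrict_univ]

/-- **Cauchy–Schwarz on a set**: `∫_s f^{1/2} g^{1/2} ≤ (∫_s f)^{1/2} (∫_s g)^{1/2}`. [folklore] -/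
theorem setLIntegral_rpow_half_mul_le (ν : Measure β) (s : Set β) {f g : β → ℝ≥0∞} (hf : Measurable f)
    (hg : Measurable g) :
    ∫⁻ b in s, f b ^ (1 / 2 : ℝ) * g b ^ (1 / 2 : ℝ) ∂ν ≤
      (∫⁻ b in s, f b ∂ν) ^ (1 / 2 : ℝ) * (∫⁻ b in s, g b ∂ν) ^ (1 / 2 : ℝ) := by
  have sq_rpow_half : ∀ m : ℝ≥0∞, (m ^ (1 / 2 : ℝ)) ^ 2 = m := fun m => by
    rw [← ENNReal.rpow_two, ← ENNReal.rpow_mul]; norm_num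
  have h := ENNReal.lintegral_mul_le_Lp_mul_Lq (ν.restrict s) Real.HolderConjugate.two_two
    (hf.pow_const (1 / 2 : ℝ)).aemeasurable (hg.pow_const (1 / 2 : ℝ)).aemeasurable
  simp only [Pi.mul_apply, ENNReal.rpow_two, sq_rpow_half] at h
  exact h

/-- **Cauchy–Schwarz on a set, squared form**: if `a₁² ≤ q₁` and `a₂² ≤ q₂` pointwise then
`∫_s a₁ a₂ ≤ (∫_s q₁)^{1/2} (∫_s q₂)^{1/2}`. [folklore] -/
theorem setLIntegral_mul_le_of_sq_le (ν : Measure β) (s : Set β) {a₁ a₂ q₁ q₂ : β → ℝ≥0∞}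
    (ha₁ : Measurable a₁) (ha₂ : Measurable a₂) (h₁ : ∀ b, a₁ b ^ 2 ≤ q₁ b) (h₂ : ∀ b, a₂ b ^ 2 ≤ q₂ b) :
    ∫⁻ b in s, a₁ b * a₂ b ∂ν ≤ (∫⁻ b in s, q₁ b ∂ν) ^ (1 / 2 : ℝ) * (∫⁻ b in s, q₂ b ∂ν) ^ (1 / 2 : ℝ) := by
  have rpow_half_sq : ∀ m : ℝ≥0∞, (m ^ 2) ^ (1 / 2 : ℝ) = m := fun m => by
    rw [← ENNReal.rpow_two, ← ENNReal.rpow_mul]; norm_num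
  calc ∫⁻ b in s, a₁ b * a₂ b ∂ν
      = ∫⁻ b in s, (a₁ b ^ 2) ^ (1 / 2 : ℝ) * (a₂ b ^ 2) ^ (1 / 2 : ℝ) ∂ν := by
        simp_rw [rpow_half_sq]
    _ ≤ (∫⁻ b in s, a₁ b ^ 2 ∂ν) ^ (1 / 2 : ℝ) * (∫⁻ b in s, a₂ b ^ 2 ∂ν) ^ (1 / 2 : ℝ) :=
        setLIntegral_rpow_half_mul_le ν s (ha₁.pow_const 2) (ha₂.pow_const 2)
    _ ≤ (∫⁻ b in s, q₁ b ∂ν) ^ (1 / 2 : ℝ) * (∫⁻ b in s, q₂ b ∂ν) ^ (1 / 2 : ℝ) :=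
        mul_le_mul' (ENNReal.rpow_le_rpow (lintegral_mono fun b => h₁ b) (by norm_num))
          (ENNReal.rpow_le_rpow (lintegral_mono fun b => h₂ b) (by norm_num))

/-- **Abstract count-affinity inequality** (data processing for the Bhattacharyya coefficient along the
statistic `T`): `∫ g^{1/2} Σᵢ wᵢ qᵢ^{1/2} ≤ Σ'_m (∫_{T=m} g)^{1/2} Σᵢ wᵢ (∫_{T=m} qᵢ)^{1/2}`. [folklore] -/
theorem label_le_count_core {ι : Type*} (s : Finset ι) (ν : Measure β) (w : ι → ℝ≥0∞) {T : β → σ}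
    (hT : Measurable T) {g : β → ℝ≥0∞} {q : ι → β → ℝ≥0∞} (hg : Measurable g)
    (hq : ∀ i, Measurable (q i)) :
    ∫⁻ b, g b ^ (1 / 2 : ℝ) * ∑ i ∈ s, w i * q i b ^ (1 / 2 : ℝ) ∂ν ≤
      ∑' m, (∫⁻ b in T ⁻¹' {m}, g b ∂ν) ^ (1 / 2 : ℝ) *
        ∑ i ∈ s, w i * (∫⁻ b in T ⁻¹' {m}, q i b ∂ν) ^ (1 / 2 : ℝ) := by
  rw [lintegral_eq_tsum_fibre ν hT]
  refine ENNReal.tsum_le_tsum fun m => ?_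
  set F : Set β := T ⁻¹' {m} with hF
  have hmeas : ∀ i, Measurable fun b => g b ^ (1 / 2 : ℝ) * q i b ^ (1 / 2 : ℝ) := fun i =>
    (hg.pow_const _).mul ((hq i).pow_const _)
  have hpt : ∀ b, g b ^ (1 / 2 : ℝ) * ∑ i ∈ s, w i * q i b ^ (1 / 2 : ℝ) =
      ∑ i ∈ s, w i * (g b ^ (1 / 2 : ℝ) * q i b ^ (1 / 2 : ℝ)) := by
    intro b
    rw [Finset.mul_sum]
    exact Finset.sum_congr rfl fun i _ => by ring
  simp_rw [hpt]
  rw [lintegral_finsetSum' _ fun i _ => ((hmeas i).const_mul (w i)).aemeasurable, Finset.mul_sum]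
  refine Finset.sum_le_sum fun i _ => ?_
  rw [lintegral_const_mul (w i) (hmeas i)]
  calc w i * ∫⁻ b in F, g b ^ (1 / 2 : ℝ) * q i b ^ (1 / 2 : ℝ) ∂ν
      ≤ w i * ((∫⁻ b in F, g b ∂ν) ^ (1 / 2 : ℝ) * (∫⁻ b in F, q i b ∂ν) ^ (1 / 2 : ℝ)) := by
        gcongr
        exact setLIntegral_rpow_half_mul_le ν F hg (hq i)
    _ = (∫⁻ b in F, g b ∂ν) ^ (1 / 2 : ℝ) * (w i * (∫⁻ b in F, q i b ∂ν) ^ (1 / 2 : ℝ)) := by ring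

/-- **Abstract count shadow**: if `a₁² ≤ q₁`, `a₂² ≤ q₂` pointwise then
`∫ a₁ a₂ ≤ Σ'_m (∫_{T=m} q₁)^{1/2} (∫_{T=m} q₂)^{1/2}`. [folklore] -/
theorem shadow_core (ν : Measure β) {T : β → σ} (hT : Measurable T) {a₁ a₂ q₁ q₂ : β → ℝ≥0∞}
    (ha₁ : Measurable a₁) (ha₂ : Measurable a₂) (h₁ : ∀ b, a₁ b ^ 2 ≤ q₁ b) (h₂ : ∀ b, a₂ b ^ 2 ≤ q₂ b) :
    ∫⁻ b, a₁ b * a₂ b ∂ν ≤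
      ∑' m, (∫⁻ b in T ⁻¹' {m}, q₁ b ∂ν) ^ (1 / 2 : ℝ) * (∫⁻ b in T ⁻¹' {m}, q₂ b ∂ν) ^ (1 / 2 : ℝ) := by
  rw [lintegral_eq_tsum_fibre ν hT]
  exact ENNReal.tsum_le_tsum fun m => setLIntegral_mul_le_of_sq_le ν _ ha₁ ha₂ h₁ h₂

/-- **Cauchy–Schwarz for series** (the set version on the counting measure). [folklore] -/
theorem tsum_rpow_half_mul_le (f g : σ → ℝ≥0∞) :
    ∑' m, f m ^ (1 / 2 : ℝ) * g m ^ (1 / 2 : ℝ) ≤ (∑' m, f m) ^ (1 / 2 : ℝ) * (∑' m, g m) ^ (1 / 2 : ℝ) := by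
  have h := setLIntegral_rpow_half_mul_le (Measure.count : Measure σ) Set.univ
    (measurable_of_countable f) (measurable_of_countable g)
  simpa only [Measure.restrict_univ, lintegral_count] using h

end Abstract

/-! ### §2  The objects: the count field, its fibres, and the count-law functionals -/

variable {n : ℕ}

/-- **The horizon-cell count field of the environment**: `m(Y)_B = #{i : Y_i ∈ Q_B}` for blocks `Q_B` of
side `ℓ` (`B ∈ P_K³`).  NEW OBSERVABLE of this node. [folklore] -/
noncomputable def countVec (ℓ : ℝ) (K : ℕ) (Y : Config n) : SubIdx K → ℕ :=
  fun B => ∑ i : Fin n, (subCell ℓ B).indicator (fun _ => (1 : ℕ)) (Y i)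

/-- The count field is a measurable statistic (values in the countable lattice `ℕ^{K³}`). [folklore] -/
theorem measurable_countVec (ℓ : ℝ) (K : ℕ) : Measurable (countVec (n := n) ℓ K) := by
  refine measurable_pi_lambda _ fun B => ?_
  refine Finset.measurable_sum _ fun i _ => ?_
  exact (measurable_const.indicator (measurableSet_subCell ℓ B)).comp (measurable_pi_apply i)

/-- `P̄(m) = ∫_{m(Y)=m} P̂(Y) dY`: the law of the environment's count field (unnormalised unless `∫Φ² = 1`).
[folklore] -/
noncomputable def fibreSlice (L : ℝ) (K : ℕ) (Φ : Config (n + 1) → ℝ) (m : SubIdx K → ℕ) : ℝ≥0∞ :=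
  ∫⁻ Y in countVec (L / (K : ℝ)) K ⁻¹' {m}, sliceSq Φ Y

/-- `Q(B,m) = ∫_{m(Y)=m} q_B(Y) dY` (`= p_N(m + e_B)(m_B + 1)/N` for a symmetric state): the joint weight of
«particle 1 in block `B`, the others have count field `m`». [folklore] -/
noncomputable def fibreMass (L : ℝ) (K : ℕ) (Φ : Config (n + 1) → ℝ) (B : SubIdx K) (m : SubIdx K → ℕ) : ℝ≥0∞ :=
  ∫⁻ Y in countVec (L / (K : ℝ)) K ⁻¹' {m}, blockMass L K Φ B Y

/-- **Count (insertion) affinity** `Σ_m P̄(m)^{1/2} Σ_B K^{-3/2} Q(B,m)^{1/2}`: the `P̄`-averaged Bhattacharyya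
coefficient between the conditional block law of the inserted particle GIVEN ONLY THE COUNTS and the uniform
law on the `K³` blocks.  A functional of the count law alone.  NEW OBJECT of this node. [folklore] -/
noncomputable def countAffinity (L : ℝ) (K : ℕ) (Φ : Config (n + 1) → ℝ) : ℝ≥0∞ :=
  ∑' m : SubIdx K → ℕ, fibreSlice L K Φ m ^ (1 / 2 : ℝ) *
    ∑ B : SubIdx K, blockWeight K * fibreMass L K Φ B m ^ (1 / 2 : ℝ)

/-- **Count-transfer affinity** `H(B,B') = Σ_m Q(B,m)^{1/2} Q(B',m)^{1/2}`: the Hellinger affinity of the count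
law under the transfer of one particle from `B'` to `B`. [folklore] -/
noncomputable def transferAffinity (L : ℝ) (K : ℕ) (Φ : Config (n + 1) → ℝ) (B B' : SubIdx K) : ℝ≥0∞ :=
  ∑' m : SubIdx K → ℕ, fibreMass L K Φ B m ^ (1 / 2 : ℝ) * fibreMass L K Φ B' m ^ (1 / 2 : ℝ)

/-- **Pair-averaged count-transfer affinity** `Σ_m (Σ_B K^{-3/2} Q(B,m)^{1/2})² = K⁻³ Σ_{B,B'} H(B,B')`.
[folklore] -/
noncomputable def countTransfer (L : ℝ) (K : ℕ) (Φ : Config (n + 1) → ℝ) : ℝ≥0∞ :=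
  ∑' m : SubIdx K → ℕ, (∑ B : SubIdx K, blockWeight K * fibreMass L K Φ B m ^ (1 / 2 : ℝ)) ^ 2

/-- **Block coherence** `G(B,B') = ∫ m_B(Y) m_{B'}(Y) dY = (1/N)⟨u_B, γ_Φ u_{B'}⟩` (real `Φ ≥ 0`): the
one-body density matrix coarse-grained to the block-flat modes. [folklore] -/
noncomputable def blockCoherence (L : ℝ) (K : ℕ) (Φ : Config (n + 1) → ℝ) (B B' : SubIdx K) : ℝ≥0∞ :=
  ∫⁻ Y : Config n, blockAmp L K Φ B Y * blockAmp L K Φ B' Y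

end Summit.AtomisticToContinuum.BoseEinsteinCondensation.Theorems.BoxCountShadow
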